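import Summits.Schanuel.Schanuel.Theorems.ZilberEacGraphUnramifiedBranch
import Summits.Schanuel.Schanuel.Theorems.ZilberEacGraphReciprocalExamples
import HarnessLib

/-!
# The equimodular class, XLV: cubic fibres decided by the unramified-branch theorem — examples

HONEST FRAMING.  Cell `pub-schanuel` (Zilber's Exponential-Algebraic Closedness, case ladder;
host summit Schanuel), seat 2, gen 25.  Instances of file XLIV
(`unprojectedDense_graph_unramifiedBranch`), all for EVERY polynomial graph `x₁ = p(x₀)` of degree
`≥ 2`, all outside THEOREM EB (gen 24) and the quadratic theorem:
* **`unprojectedDense_graph_cubicFibre`**: the general cubic fibre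
  `q₃(x₀)y₀³ + q₂(x₀)y₀² + q₁(x₀)y₀ + q₀(x₀)` with a simple nonzero top-row root and an unramified
  zero (`q₀(a) = 0 ≠ q₁(a)`) or pole (`q₃(a) = 0 ≠ q₂(a)`, `q₀ ≠ 0`);
* **`{x₁ = p(x₀), x₀y₀³ + y₀ + x₀ = 0}`** (reciprocal type `q₀ = q₃ = x₀`, unramified zero at
  `x₀ = 0`) and **`{x₁ = p(x₀), x₀y₀³ + y₀² + x₀ = 0}`** (reciprocal type, `q₁ = 0`: an unramified
  POLE at `x₀ = 0`) — the `y₀`-degree-3 reciprocal members named open after gen 24;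
* **`{x₁ = p(x₀), x₀y₀³ - x₀y₀² + (1 - x₀)y₀ + x₀ = 0}`**: top row `(X - 1)²(X + 1)` has a DOUBLE
  root (ramified branches at infinity, outside every earlier theorem) and is of reciprocal type;
  dense by the simple root `θ = -1` and the unramified zero at `x₀ = 0`.
Each surface is in Mantova–Masser's case (`dim π₁ = 1`, free).  Complete instances of an OPEN
question (Mantova–Masser, PLMS 2024 §1 p. 5); EC(3,2) OPEN; NOT Schanuel's conjecture (neither used
nor implied; EAC ⇏ SC).
-/

noncomputable section

open Filter Topology Set Complex MvPolynomial
open Literature.NumberTheory.Transcendental Literature.ModelTheory.Zilber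
open Literature.ModelTheory.ExponentialFields

set_option linter.dupNamespace false

namespace Summit.Schanuel.Schanuel.Theorems

/-! ## Part A. Cubic fibres -/

/-- Coefficients of a cubic in `ℂ[s][t]`. [folklore] -/
theorem coeff_cubicRows (q₀ q₁ q₂ q₃ : Polynomial ℂ) (j : ℕ) :
    (Polynomial.C q₃ * Polynomial.X ^ 3 + Polynomial.C q₂ * Polynomial.X ^ 2 + Polynomial.C q₁ * Polynomial.X +
        Polynomial.C q₀ : Polynomial (Polynomial ℂ)).coeff j =
      if j = 3 then q₃ else if j = 2 then q₂ else if j = 1 then q₁ else if j = 0 then q₀ else 0 := by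
  simp only [Polynomial.coeff_add, Polynomial.coeff_C_mul, Polynomial.coeff_X_pow, Polynomial.coeff_X,
    Polynomial.coeff_C]
  rcases j with _ | _ | _ | _ | j <;> simp

/-- **Cubic fibres with a simple nonzero top-row root and an unramified zero or pole are dense over
polynomial graphs of degree `≥ 2`** (file XLIV specialised).
[cite: MantovaMasser2023, §1 Further remarks, p. 5 (the question, open in general)] (new) -/
theorem unprojectedDense_graph_cubicFibre (q₀ q₁ q₂ q₃ : Polynomial ℂ) {P : MvPolynomial (Fin 2) ℂ}
    (hP : ∀ x y : ℂ, MvPolynomial.eval ![x, y] P =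
      q₃.eval x * y ^ 3 + q₂.eval x * y ^ 2 + q₁.eval x * y + q₀.eval x)
    (hirr : Irreducible P) (hq₃ : q₃ ≠ 0) (N : ℕ) (hN₃ : q₃.natDegree ≤ N) (hN₂ : q₂.natDegree ≤ N)
    (hN₁ : q₁.natDegree ≤ N) (hN₀ : q₀.natDegree ≤ N) {θ : ℂ} (hθ0 : θ ≠ 0)
    (hTθ : (Polynomial.C (q₃.coeff N) * Polynomial.X ^ 3 + Polynomial.C (q₂.coeff N) * Polynomial.X ^ 2 +
      Polynomial.C (q₁.coeff N) * Polynomial.X + Polynomial.C (q₀.coeff N)).IsRoot θ)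
    (hT'θ : (Polynomial.derivative (Polynomial.C (q₃.coeff N) * Polynomial.X ^ 3 +
      Polynomial.C (q₂.coeff N) * Polynomial.X ^ 2 + Polynomial.C (q₁.coeff N) * Polynomial.X +
      Polynomial.C (q₀.coeff N))).eval θ ≠ 0)
    (hpt : (∃ a : ℂ, q₀.IsRoot a ∧ ¬ q₁.IsRoot a) ∨ (q₀ ≠ 0 ∧ ∃ a : ℂ, q₃.IsRoot a ∧ ¬ q₂.IsRoot a))
    (p : Polynomial ℂ) (hd : 2 ≤ p.natDegree) :
    UnprojectedDense {w : Fin 2 ⊕ Fin 2 → ℂ | w (Sum.inl 1) = p.eval (w (Sum.inl 0)) ∧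
      MvPolynomial.eval ![w (Sum.inl 0), w (Sum.inr 0)] P = 0} := by
  classical
  set Q : Polynomial (Polynomial ℂ) := Polynomial.C q₃ * Polynomial.X ^ 3 + Polynomial.C q₂ * Polynomial.X ^ 2 +
    Polynomial.C q₁ * Polynomial.X + Polynomial.C q₀ with hQ
  set T : Polynomial ℂ := Polynomial.C (q₃.coeff N) * Polynomial.X ^ 3 + Polynomial.C (q₂.coeff N) * Polynomial.X ^ 2 +
    Polynomial.C (q₁.coeff N) * Polynomial.X + Polynomial.C (q₀.coeff N) with hTdef
  have hPQ : ∀ x y : ℂ, MvPolynomial.eval ![x, y] P = (Q.map (Polynomial.evalRingHom x)).eval y := by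
    intro x y
    rw [hP, hQ]
    simp only [Polynomial.map_add, Polynomial.map_mul, Polynomial.map_C, Polynomial.map_pow,
      Polynomial.map_X, Polynomial.coe_evalRingHom, Polynomial.eval_add, Polynomial.eval_mul,
      Polynomial.eval_C, Polynomial.eval_pow, Polynomial.eval_X]
  have hcoefQ : ∀ j, Q.coeff j =
      if j = 3 then q₃ else if j = 2 then q₂ else if j = 1 then q₁ else if j = 0 then q₀ else 0 :=
    fun j => coeff_cubicRows q₀ q₁ q₂ q₃ j
  have hcoefT : ∀ j, T.coeff j = if j = 3 then q₃.coeff N else if j = 2 then q₂.coeff N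
      else if j = 1 then q₁.coeff N else if j = 0 then q₀.coeff N else 0 := by
    intro j
    simp only [hTdef, Polynomial.coeff_add, Polynomial.coeff_C_mul, Polynomial.coeff_X_pow, Polynomial.coeff_X,
      Polynomial.coeff_C]
    rcases j with _ | _ | _ | _ | j <;> simp
  have hN : ∀ j, (Q.coeff j).natDegree ≤ N := by
    intro j
    rw [hcoefQ]
    split_ifs
    · exact hN₃
    · exact hN₂
    · exact hN₁
    · exact hN₀
    · simp
  have hT : ∀ j, T.coeff j = (Q.coeff j).coeff N := by
    intro j
    rw [hcoefT, hcoefQ]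
    split_ifs <;> simp
  have hQdeg : Q.natDegree = 3 := by rw [hQ]; exact Polynomial.natDegree_cubic hq₃
  have hT0 : T ≠ 0 := by
    intro h
    rw [h] at hTθ hT'θ
    simp at hT'θ
  refine unprojectedDense_graph_unramifiedBranch Q hPQ hirr N hN T hT hT0 hθ0 hTθ hT'θ ?_ p hd
  rcases hpt with ⟨a, ha, ha'⟩ | ⟨hq₀, a, ha, ha'⟩
  · refine Or.inl ⟨a, ?_, ?_⟩
    · rw [hcoefQ]; simpa using ha
    · rw [hcoefQ]; simpa using ha'
  · refine Or.inr ⟨by rw [hcoefQ]; simpa using hq₀, a, ?_, ?_⟩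
    · rw [hQdeg, hcoefQ]; simpa using ha
    · rw [hQdeg, hcoefQ]; simpa using ha'

/-- Cubic fibre surfaces `x₀y₀³ + B(y₀) + x₀ = 0`-style are in Mantova–Masser's case: a helper giving
infinitely many `x₀` with a nonzero fibre point, for a fibre `t·y³ + b₂ y² + b₁ y + t`. [folklore] -/
theorem infinite_fibre_cubic (b₁ b₂ : ℂ) :
    Set.Infinite {t : ℂ | ∃ y : ℂ, y ≠ 0 ∧ t * y ^ 3 + b₂ * y ^ 2 + b₁ * y + t = 0} := by
  refine (Set.finite_singleton (0 : ℂ)).infinite_compl.mono ?_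
  intro t ht
  simp only [Set.mem_compl_iff, Set.mem_singleton_iff] at ht
  set q : Polynomial ℂ := Polynomial.C t * Polynomial.X ^ 3 + Polynomial.C b₂ * Polynomial.X ^ 2 +
    Polynomial.C b₁ * Polynomial.X + Polynomial.C t with hq
  have hqdeg : 0 < q.degree := by
    rw [hq, Polynomial.degree_cubic ht]; norm_num
  obtain ⟨y, hy⟩ := Complex.exists_root hqdeg
  have hy' : t * y ^ 3 + b₂ * y ^ 2 + b₁ * y + t = 0 := by
    have := hy.eq_zero
    simp only [hq, Polynomial.eval_add, Polynomial.eval_mul, Polynomial.eval_C, Polynomial.eval_pow,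
      Polynomial.eval_X] at this
    exact this
  refine ⟨y, ?_, hy'⟩
  rintro rfl
  apply ht
  simpa using hy'

/-! ## Part B. The examples -/

/-- `x₀y₀³ + y₀ + x₀` is irreducible. -/
theorem irreducible_cubicReciprocalFibre₁ :
    Irreducible (X 0 * X 1 ^ 3 + X 1 + X 0 : MvPolynomial (Fin 2) ℂ) := by
  have himage : MvPolynomial.finSuccEquiv ℂ 1 (X 0 * X 1 ^ 3 + X 1 + X 0) =
      Polynomial.C (X 0 ^ 3 + 1 : MvPolynomial (Fin 1) ℂ) * Polynomial.X +
        Polynomial.C (X 0 : MvPolynomial (Fin 1) ℂ) := by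
    rw [map_add, map_add, map_mul, map_pow, MvPolynomial.finSuccEquiv_X_zero,
      show (X 1 : MvPolynomial (Fin 2) ℂ) = X (Fin.succ 0) from rfl, MvPolynomial.finSuccEquiv_X_succ,
      map_add, map_pow, map_one]
    ring
  have ha : (X 0 ^ 3 + 1 : MvPolynomial (Fin 1) ℂ) ≠ 0 := by
    intro h
    have := congrArg (MvPolynomial.eval fun _ => (0 : ℂ)) h
    simp at this
  have hcop : IsCoprime (X 0 ^ 3 + 1 : MvPolynomial (Fin 1) ℂ) (X 0) := ⟨1, -X 0 ^ 2, by ring⟩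
  have hirr := irreducible_C_mul_X_add_C_of_isCoprime ha hcop
  rw [← himage] at hirr
  exact (MulEquiv.irreducible_iff (MvPolynomial.finSuccEquiv ℂ 1).toMulEquiv).1 hirr

/-- `x₀y₀³ + y₀² + x₀` is irreducible. -/
theorem irreducible_cubicReciprocalFibre₂ :
    Irreducible (X 0 * X 1 ^ 3 + X 1 ^ 2 + X 0 : MvPolynomial (Fin 2) ℂ) := by
  have himage : MvPolynomial.finSuccEquiv ℂ 1 (X 0 * X 1 ^ 3 + X 1 ^ 2 + X 0) =
      Polynomial.C (X 0 ^ 3 + 1 : MvPolynomial (Fin 1) ℂ) * Polynomial.X +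
        Polynomial.C (X 0 ^ 2 : MvPolynomial (Fin 1) ℂ) := by
    rw [show (X 1 : MvPolynomial (Fin 2) ℂ) = X (Fin.succ 0) from rfl]
    simp only [map_add, map_mul, map_pow, map_one, MvPolynomial.finSuccEquiv_X_zero,
      MvPolynomial.finSuccEquiv_X_succ]
    ring
  have ha : (X 0 ^ 3 + 1 : MvPolynomial (Fin 1) ℂ) ≠ 0 := by
    intro h
    have := congrArg (MvPolynomial.eval fun _ => (0 : ℂ)) h
    simp at this
  have hcop : IsCoprime (X 0 ^ 3 + 1 : MvPolynomial (Fin 1) ℂ) (X 0 ^ 2) := ⟨1, -X 0, by ring⟩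
  have hirr := irreducible_C_mul_X_add_C_of_isCoprime ha hcop
  rw [← himage] at hirr
  exact (MulEquiv.irreducible_iff (MvPolynomial.finSuccEquiv ℂ 1).toMulEquiv).1 hirr

/-- `x₀y₀³ - x₀y₀² - x₀y₀ + y₀ + x₀` is irreducible. -/
theorem irreducible_cubicRamifiedFibre :
    Irreducible (X 0 * X 1 ^ 3 - X 0 * X 1 ^ 2 - X 0 * X 1 + X 1 + X 0 : MvPolynomial (Fin 2) ℂ) := by
  have himage : MvPolynomial.finSuccEquiv ℂ 1 (X 0 * X 1 ^ 3 - X 0 * X 1 ^ 2 - X 0 * X 1 + X 1 + X 0) =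
      Polynomial.C (X 0 ^ 3 - X 0 ^ 2 - X 0 + 1 : MvPolynomial (Fin 1) ℂ) * Polynomial.X +
        Polynomial.C (X 0 : MvPolynomial (Fin 1) ℂ) := by
    rw [show (X 1 : MvPolynomial (Fin 2) ℂ) = X (Fin.succ 0) from rfl]
    simp only [map_add, map_sub, map_mul, map_pow, map_one, MvPolynomial.finSuccEquiv_X_zero,
      MvPolynomial.finSuccEquiv_X_succ]
    ring
  have ha : (X 0 ^ 3 - X 0 ^ 2 - X 0 + 1 : MvPolynomial (Fin 1) ℂ) ≠ 0 := by
    intro h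
    have := congrArg (MvPolynomial.eval fun _ => (0 : ℂ)) h
    simp at this
  have hcop : IsCoprime (X 0 ^ 3 - X 0 ^ 2 - X 0 + 1 : MvPolynomial (Fin 1) ℂ) (X 0) :=
    ⟨1, -(X 0 ^ 2 - X 0 - 1), by ring⟩
  have hirr := irreducible_C_mul_X_add_C_of_isCoprime ha hcop
  rw [← himage] at hirr
  exact (MulEquiv.irreducible_iff (MvPolynomial.finSuccEquiv ℂ 1).toMulEquiv).1 hirr

/-- **`{x₁ = p(x₀), x₀y₀³ + y₀ + x₀ = 0}` (reciprocal cubic fibre, unramified zero at `x₀ = 0`) is in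
Mantova–Masser's case and DENSE** for every `p` of degree `≥ 2` (top row `X³ + 1`, `θ = -1`).
[cite: MantovaMasser2023, §1 Further remarks, p. 5 (the question, open in general)] (new) -/
theorem unprojectedDensityQuestion_graph_cubicReciprocalFibre₁ (p : Polynomial ℂ) (hd : 2 ≤ p.natDegree) :
    MMCaseDimPiOneFree {w : Fin 2 ⊕ Fin 2 → ℂ | w (Sum.inl 1) = p.eval (w (Sum.inl 0)) ∧
      w (Sum.inl 0) * w (Sum.inr 0) ^ 3 + w (Sum.inr 0) + w (Sum.inl 0) = 0} ∧
    UnprojectedDense {w : Fin 2 ⊕ Fin 2 → ℂ | w (Sum.inl 1) = p.eval (w (Sum.inl 0)) ∧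
      w (Sum.inl 0) * w (Sum.inr 0) ^ 3 + w (Sum.inr 0) + w (Sum.inl 0) = 0} := by
  classical
  set P : MvPolynomial (Fin 2) ℂ := X 0 * X 1 ^ 3 + X 1 + X 0 with hPdef
  have hset : {w : Fin 2 ⊕ Fin 2 → ℂ | w (Sum.inl 1) = p.eval (w (Sum.inl 0)) ∧
      w (Sum.inl 0) * w (Sum.inr 0) ^ 3 + w (Sum.inr 0) + w (Sum.inl 0) = 0} =
      {w : Fin 2 ⊕ Fin 2 → ℂ | w (Sum.inl 1) = p.eval (w (Sum.inl 0)) ∧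
        MvPolynomial.eval ![w (Sum.inl 0), w (Sum.inr 0)] P = 0} := by
    ext w
    simp only [Set.mem_setOf_eq, hPdef, MvPolynomial.eval_X, map_add, map_mul, map_pow,
      Matrix.cons_val_zero, Matrix.cons_val_one]
  rw [hset]
  have hirr : Irreducible P := irreducible_cubicReciprocalFibre₁
  have hP : ∀ x y : ℂ, MvPolynomial.eval ![x, y] P =
      (Polynomial.X : Polynomial ℂ).eval x * y ^ 3 + (0 : Polynomial ℂ).eval x * y ^ 2 +
        (1 : Polynomial ℂ).eval x * y + (Polynomial.X : Polynomial ℂ).eval x := by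
    intro x y
    simp [hPdef]
  refine ⟨mmCase_fibreCurveSurface p hd hirr ((infinite_fibre_cubic 1 0).mono ?_), ?_⟩
  · rintro t ⟨y, hy, hty⟩
    refine ⟨y, hy, ?_⟩
    simp only [hPdef, map_add, map_mul, map_pow, MvPolynomial.eval_X, Matrix.cons_val_zero,
      Matrix.cons_val_one]
    linear_combination hty
  · refine unprojectedDense_graph_cubicFibre Polynomial.X 1 0 Polynomial.X hP hirr Polynomial.X_ne_zero 1
      Polynomial.natDegree_X_le (by simp) (by simp) Polynomial.natDegree_X_le (θ := -1)
      (by norm_num) ?_ ?_ (Or.inl ⟨0, by simp, by simp⟩) p hd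
    · simp [Polynomial.coeff_one]; norm_num
    · simp [Polynomial.coeff_one]; norm_num

/-- **`{x₁ = p(x₀), x₀y₀³ + y₀² + x₀ = 0}` (reciprocal cubic fibre with `q₁ = 0`: an unramified POLE
at `x₀ = 0`) is in Mantova–Masser's case and DENSE** for every `p` of degree `≥ 2`.
[cite: MantovaMasser2023, §1 Further remarks, p. 5 (the question, open in general)] (new) -/
theorem unprojectedDensityQuestion_graph_cubicReciprocalFibre₂ (p : Polynomial ℂ) (hd : 2 ≤ p.natDegree) :
    MMCaseDimPiOneFree {w : Fin 2 ⊕ Fin 2 → ℂ | w (Sum.inl 1) = p.eval (w (Sum.inl 0)) ∧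
      w (Sum.inl 0) * w (Sum.inr 0) ^ 3 + w (Sum.inr 0) ^ 2 + w (Sum.inl 0) = 0} ∧
    UnprojectedDense {w : Fin 2 ⊕ Fin 2 → ℂ | w (Sum.inl 1) = p.eval (w (Sum.inl 0)) ∧
      w (Sum.inl 0) * w (Sum.inr 0) ^ 3 + w (Sum.inr 0) ^ 2 + w (Sum.inl 0) = 0} := by
  classical
  set P : MvPolynomial (Fin 2) ℂ := X 0 * X 1 ^ 3 + X 1 ^ 2 + X 0 with hPdef
  have hset : {w : Fin 2 ⊕ Fin 2 → ℂ | w (Sum.inl 1) = p.eval (w (Sum.inl 0)) ∧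
      w (Sum.inl 0) * w (Sum.inr 0) ^ 3 + w (Sum.inr 0) ^ 2 + w (Sum.inl 0) = 0} =
      {w : Fin 2 ⊕ Fin 2 → ℂ | w (Sum.inl 1) = p.eval (w (Sum.inl 0)) ∧
        MvPolynomial.eval ![w (Sum.inl 0), w (Sum.inr 0)] P = 0} := by
    ext w
    simp only [Set.mem_setOf_eq, hPdef, MvPolynomial.eval_X, map_add, map_mul, map_pow,
      Matrix.cons_val_zero, Matrix.cons_val_one]
  rw [hset]
  have hirr : Irreducible P := irreducible_cubicReciprocalFibre₂
  have hP : ∀ x y : ℂ, MvPolynomial.eval ![x, y] P =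
      (Polynomial.X : Polynomial ℂ).eval x * y ^ 3 + (1 : Polynomial ℂ).eval x * y ^ 2 +
        (0 : Polynomial ℂ).eval x * y + (Polynomial.X : Polynomial ℂ).eval x := by
    intro x y
    simp [hPdef]
  refine ⟨mmCase_fibreCurveSurface p hd hirr ((infinite_fibre_cubic 0 1).mono ?_), ?_⟩
  · rintro t ⟨y, hy, hty⟩
    refine ⟨y, hy, ?_⟩
    simp only [hPdef, map_add, map_mul, map_pow, MvPolynomial.eval_X, Matrix.cons_val_zero,
      Matrix.cons_val_one]
    linear_combination hty
  · refine unprojectedDense_graph_cubicFibre Polynomial.X 0 1 Polynomial.X hP hirr Polynomial.X_ne_zero 1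
      Polynomial.natDegree_X_le (by simp) (by simp) Polynomial.natDegree_X_le (θ := -1)
      (by norm_num) ?_ ?_ (Or.inr ⟨Polynomial.X_ne_zero, 0, by simp, by simp⟩) p hd
    · simp [Polynomial.coeff_one]; norm_num
    · simp [Polynomial.coeff_one]; norm_num

/-- **`{x₁ = p(x₀), x₀y₀³ - x₀y₀² + (1 - x₀)y₀ + x₀ = 0}` — top row `(X - 1)²(X + 1)` with a DOUBLE
root (ramified branches at infinity) — is in Mantova–Masser's case and DENSE** for every `p` of degree
`≥ 2` (simple root `θ = -1`, unramified zero at `x₀ = 0`).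
[cite: MantovaMasser2023, §1 Further remarks, p. 5 (the question, open in general)] (new) -/
theorem unprojectedDensityQuestion_graph_cubicRamifiedFibre (p : Polynomial ℂ) (hd : 2 ≤ p.natDegree) :
    MMCaseDimPiOneFree {w : Fin 2 ⊕ Fin 2 → ℂ | w (Sum.inl 1) = p.eval (w (Sum.inl 0)) ∧
      w (Sum.inl 0) * w (Sum.inr 0) ^ 3 - w (Sum.inl 0) * w (Sum.inr 0) ^ 2 -
        w (Sum.inl 0) * w (Sum.inr 0) + w (Sum.inr 0) + w (Sum.inl 0) = 0} ∧
    UnprojectedDense {w : Fin 2 ⊕ Fin 2 → ℂ | w (Sum.inl 1) = p.eval (w (Sum.inl 0)) ∧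
      w (Sum.inl 0) * w (Sum.inr 0) ^ 3 - w (Sum.inl 0) * w (Sum.inr 0) ^ 2 -
        w (Sum.inl 0) * w (Sum.inr 0) + w (Sum.inr 0) + w (Sum.inl 0) = 0} := by
  classical
  set P : MvPolynomial (Fin 2) ℂ := X 0 * X 1 ^ 3 - X 0 * X 1 ^ 2 - X 0 * X 1 + X 1 + X 0 with hPdef
  have hset : {w : Fin 2 ⊕ Fin 2 → ℂ | w (Sum.inl 1) = p.eval (w (Sum.inl 0)) ∧
      w (Sum.inl 0) * w (Sum.inr 0) ^ 3 - w (Sum.inl 0) * w (Sum.inr 0) ^ 2 -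
        w (Sum.inl 0) * w (Sum.inr 0) + w (Sum.inr 0) + w (Sum.inl 0) = 0} =
      {w : Fin 2 ⊕ Fin 2 → ℂ | w (Sum.inl 1) = p.eval (w (Sum.inl 0)) ∧
        MvPolynomial.eval ![w (Sum.inl 0), w (Sum.inr 0)] P = 0} := by
    ext w
    simp only [Set.mem_setOf_eq, hPdef, MvPolynomial.eval_X, map_add, map_sub, map_mul, map_pow,
      Matrix.cons_val_zero, Matrix.cons_val_one]
  rw [hset]
  have hirr : Irreducible P := irreducible_cubicRamifiedFibre
  have hP : ∀ x y : ℂ, MvPolynomial.eval ![x, y] P =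
      (Polynomial.X : Polynomial ℂ).eval x * y ^ 3 + (-Polynomial.X : Polynomial ℂ).eval x * y ^ 2 +
        (1 - Polynomial.X : Polynomial ℂ).eval x * y + (Polynomial.X : Polynomial ℂ).eval x := by
    intro x y
    simp [hPdef]
    ring
  refine ⟨mmCase_fibreCurveSurface p hd hirr ?_, ?_⟩
  · -- every `t ≠ 0` has a nonzero fibre point
    refine (Set.finite_singleton (0 : ℂ)).infinite_compl.mono ?_
    intro t ht
    simp only [Set.mem_compl_iff, Set.mem_singleton_iff] at ht
    set q : Polynomial ℂ := Polynomial.C t * Polynomial.X ^ 3 + Polynomial.C (-t) * Polynomial.X ^ 2 +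
      Polynomial.C (1 - t) * Polynomial.X + Polynomial.C t with hq
    have hqdeg : 0 < q.degree := by
      rw [hq, Polynomial.degree_cubic ht]; norm_num
    obtain ⟨y, hy⟩ := Complex.exists_root hqdeg
    have hy' : t * y ^ 3 + -t * y ^ 2 + (1 - t) * y + t = 0 := by
      have := hy.eq_zero
      simp only [hq, Polynomial.eval_add, Polynomial.eval_mul, Polynomial.eval_C, Polynomial.eval_pow,
        Polynomial.eval_X] at this
      exact this
    refine ⟨y, ?_, ?_⟩
    · rintro rfl
      apply ht
      simpa using hy'
    · simp only [hPdef, map_add, map_sub, map_mul, map_pow, MvPolynomial.eval_X, Matrix.cons_val_zero,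
        Matrix.cons_val_one]
      linear_combination hy'
  · refine unprojectedDense_graph_cubicFibre Polynomial.X (1 - Polynomial.X) (-Polynomial.X) Polynomial.X hP
      hirr Polynomial.X_ne_zero 1 Polynomial.natDegree_X_le ?_ ?_ Polynomial.natDegree_X_le (θ := -1)
      (by norm_num) ?_ ?_ (Or.inl ⟨0, by simp, by simp⟩) p hd
    · rw [Polynomial.natDegree_neg]; exact Polynomial.natDegree_X_le
    · exact (Polynomial.natDegree_sub_le _ _).trans (by simp)
    · simp [Polynomial.coeff_one]; norm_num
    · simp [Polynomial.coeff_one]; norm_num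

end Summit.Schanuel.Schanuel.Theorems
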